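import Summits.CriticalPhenomena.PercolationContinuityZ3.Theorems.Transplant.SkelFrmBParamsFaceOriginsXA
import Summits.CriticalPhenomena.PercolationContinuityZ3.Theorems.Transplant.PlanarSkeletonFrmDefs
import Summits.CriticalPhenomena.PercolationContinuityZ3.Theorems.Transplant.SkelPhiStepIDataNS
import HarnessLib
/-!
(F) VALUE LAYER, N2 twin (hp-8 g42, 2026-08-23; F-DISCHARGE-MAP-N2 G18 x-face LANDING ORIGINS at the (F) bridge, cases d/t (transposed)): `port_frm.py` text of
N1 `SkelNegBParamsFaceOriginsXTA` (p3-g13) over OriginsXA-N2 (`yLof` & co); kit radius `KS0.R'0` (J19; `qBXFd/qBXFt` at `R'0`); slot-floor reads →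
the hypotheses of record `hR0 : 22000·(R'0+2) ≤ M_L(gT mk gx)`, `hnA : 2000·Kq·(R'0+2) ≤ n_L` (stmt-g21 (S2)). Cell-free.
NON-VACUITY: hypotheses = Step I at `(gT mk gx, fT mk fx)`, `16·S_F ≤ M_L`, `hR0`, `hnA`, the steep/top case splits of N1.
builds on p205010 (kernel theorem, internal audit signed; external expert review pending); nothing here is a claim about the open node `SamePDropOfSkeletonFrm₁`.
N1 HEADER (kept for the reader):
# N1 (the `{±1}` node), M3 (the x-face linear floors at the (ζ′) tuple), group G-O part 2: **THE x-FACE LANDING ORIGIN AT THE WIDE (F) BRIDGE,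
# the two TRANSPOSED cases** (`o_b = tr o_L`; steep `KS.BFd σ = bridgeTrSide`, `ℓBF < 2|hBF|`; flat `KS.BFt σ = bridgeTrTop`, `2|hBF| ≤ ℓBF`) — the
# RootCasesT twins at the F pair (`nBF/hBF/ℓBF c mk`): `d0XFd := ⌊(2|hBF| + ℓBF)/2⌋`, **`yLXFd σ := yLof σ d0XFd (sgnz hBF·nBF) ⌊ℓ_L/2⌋`**,
# **`qBXFd := RA′ + ⌊ℓBF/2⌋ + 1`**, **`yLXFt σ := yLof σ (ℓBF − 5) 0 ⌊ℓ_L/2⌋`**, **`qBXFt := RA′ + |hBF| + 6`**; the core-`1` coordinates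
# `mem_core1XF_side_iff` / `mem_core1XF_top_iff`; **`hxaXF_d/t`** (`|x₀ − σ·yL₀| ≤ qB` on core `1`); **`hyL_XFd/t`** (p1-g14's clearance premise
# `M_u < σ·yL₀ − qB − RA′ − n_L`, from `bF = M_u + (c+2)RA′ + 1` and `2bF + 27 ≤ ℓBF`); at the `T` slots **`four_qBXFdt_le`**, **`Λ_XFsdt`**
# (`|Λ₀| ≤ 3m`, `|Λ₁| ≤ 2m` at all three origins, `27 ≤ ℓBF`), **`hxbXF_d/t`** (core `1` inside the start window) — every R-pair floor `16·S ≤ M_L`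
# replaced by the hypothesis `16·S_F ≤ M_L` (`KS.ML_floorsA … .2.2.2.1`-shape at `gx := gxA c`).  Part 1 (case same + readings): SkelNegBParamsFaceOriginsXA; part 3 (the `ℓ¹` sizes `yLXF?_l1` for G-π's `hyl`): SkelNegBParamsFaceOriginsXLA.

builds on p205010 (kernel theorem, internal audit signed; external expert review pending) — nothing in this file uses p205010; NOTHING is claimed about
the open node `SamePDropOfSkeletonNeg₁`: pure arithmetic of the (ζ′) parameter files.
Lane `prim-bschramm`, seat `prim-bschramm-p3` (gen 12; N1 design owner, M3 integrator); helper file (`--supports stmt-CriticalPhenomena-4575 --as helper`).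
[cite: KozmaNitzan2024, §4 p. 28 ((32)), Lemma 10 Step IV (pp. 17–21)] [cite: MartineauTassion2017, §3.2, §4.3]
-/

noncomputable section

open scoped Classical

namespace Summit.CriticalPhenomena.PercolationContinuityZ3.Theorems.Transplant

namespace PlanarSkeletonFrm

namespace NegB

open Literature.Probability.Percolation Literature.Probability.LatticeModels SimpleGraph
open SkelConc (Consts)
open Skelφ (shearUnit shearUnit_pos sgnz sgnz_cases)
open Skelφ.StepI (DataN)
open ChainPlanar (BridgePrm)
open TwoAxis.Para (modulus)
open Neg

namespace KS

/-! ## §3 The values and the slot-free readings (cases d/t) -/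

section Defs

/-- Along-displacement centre, steep transposed case: `⌊(2|h_b| + ℓ_b)/2⌋`. [this work] -/
def d0XFd (κ : Consts) {V : Type} [DecidableEq V] [Countable V] {G : SimpleGraph V} [G.LocallyFinite] (Φ : PlanarSkeletonFrm G) (t : V) (p : unitInterval) (D : Skelφ.StepI.DataNS V) (c : ℕ) (mk : ℕ) : ℤ := (2 * |hBF κ Φ t p D c mk| + ℓBF κ Φ t p D c mk) / 2

/-- **The run origin, steep transposed case** (centre of `bridgeTrSide`'s core `1`). [this work] -/
def yLXFd (κ : Consts) {V : Type} [DecidableEq V] [Countable V] {G : SimpleGraph V} [G.LocallyFinite] (Φ : PlanarSkeletonFrm G) (t : V) (p : unitInterval) (D : Skelφ.StepI.DataNS V) (c : ℕ) (mk : ℕ) (g : ℕ) (f : ℕ) (σ : ℤ) : Site 2 := yLof κ Φ t p D g f σ (d0XFd κ Φ t p D c mk) (sgnz (hBF κ Φ t p D c mk) * nBF κ Φ t p D c mk) ((ℓL κ Φ t p D g f : ℤ) / 2)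

/-- **The start half-width, steep transposed case**: `RA′ + ⌊ℓ_b/2⌋ + 1`. [this work] -/
def qBXFd (κ : Consts) {V : Type} [DecidableEq V] [Countable V] {G : SimpleGraph V} [G.LocallyFinite] (Φ : PlanarSkeletonFrm G) (t : V) (p : unitInterval) (D : Skelφ.StepI.DataNS V) (c : ℕ) (mk : ℕ) : ℕ := KS0.R'0 κ Φ t p D mk + ℓBF κ Φ t p D c mk / 2 + 1

/-- **The run origin, flat transposed case** (centre of `bridgeTrTop`'s core `1`: `d₀ := ℓ_b − 5`, `d₁ := 0`). [this work] -/
def yLXFt (κ : Consts) {V : Type} [DecidableEq V] [Countable V] {G : SimpleGraph V} [G.LocallyFinite] (Φ : PlanarSkeletonFrm G) (t : V) (p : unitInterval) (D : Skelφ.StepI.DataNS V) (c : ℕ) (mk : ℕ) (g : ℕ) (f : ℕ) (σ : ℤ) : Site 2 := yLof κ Φ t p D g f σ ((ℓBF κ Φ t p D c mk : ℤ) - 5) 0 ((ℓL κ Φ t p D g f : ℤ) / 2)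

/-- **The start half-width, flat transposed case**: `RA′ + |h_b| + 6`. [this work] -/
def qBXFt (κ : Consts) {V : Type} [DecidableEq V] [Countable V] {G : SimpleGraph V} [G.LocallyFinite] (Φ : PlanarSkeletonFrm G) (t : V) (p : unitInterval) (D : Skelφ.StepI.DataNS V) (c : ℕ) (mk : ℕ) : ℕ := KS0.R'0 κ Φ t p D mk + (hBF κ Φ t p D c mk).natAbs + 6

/-- Core `1` of `bridgeTrSide` in coordinates. [folklore] -/
theorem mem_core1XF_side_iff (κ : Consts) {V : Type} [DecidableEq V] [Countable V] {G : SimpleGraph V} [G.LocallyFinite] (Φ : PlanarSkeletonFrm G) (t : V) (p : unitInterval) (D : Skelφ.StepI.DataNS V) (c : ℕ) (mk : ℕ) (g : ℕ) (f : ℕ) (σ : ℤ) (x : Site 2) :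
    x ∈ Finset.Icc (Skelφ.bridgeTrSide σ (nL κ Φ t p D g f) (hL κ Φ t p D g f) (ℓL κ Φ t p D g f) (KS0.R'0 κ Φ t p D mk) (nBF κ Φ t p D c mk) (hBF κ Φ t p D c mk) (ℓBF κ Φ t p D c mk)).core1Lo (Skelφ.bridgeTrSide σ (nL κ Φ t p D g f) (hL κ Φ t p D g f) (ℓL κ Φ t p D g f) (KS0.R'0 κ Φ t p D mk) (nBF κ Φ t p D c mk) (hBF κ Φ t p D c mk) (ℓBF κ Φ t p D c mk)).core1Hi ↔
      ((nL κ Φ t p D g f : ℤ) - KS0.R'0 κ Φ t p D mk + |hBF κ Φ t p D c mk| ≤ x 0 ∧ x 0 ≤ (nL κ Φ t p D g f : ℤ) + KS0.R'0 κ Φ t p D mk + (|hBF κ Φ t p D c mk| + ℓBF κ Φ t p D c mk)) ∧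
        (σ * hL κ Φ t p D g f - KS0.R'0 κ Φ t p D mk + σ * sgnz (hBF κ Φ t p D c mk) * nBF κ Φ t p D c mk ≤ x 1 ∧
          x 1 ≤ σ * hL κ Φ t p D g f + ℓL κ Φ t p D g f + KS0.R'0 κ Φ t p D mk + σ * sgnz (hBF κ Φ t p D c mk) * nBF κ Φ t p D c mk) := by
  have hlo : (Skelφ.bridgeTrSide σ (nL κ Φ t p D g f) (hL κ Φ t p D g f) (ℓL κ Φ t p D g f) (KS0.R'0 κ Φ t p D mk) (nBF κ Φ t p D c mk) (hBF κ Φ t p D c mk) (ℓBF κ Φ t p D c mk)).core1Lo =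
      Skelφ.pt ((nL κ Φ t p D g f : ℤ) - KS0.R'0 κ Φ t p D mk + |hBF κ Φ t p D c mk|) (σ * hL κ Φ t p D g f - KS0.R'0 κ Φ t p D mk + σ * sgnz (hBF κ Φ t p D c mk) * nBF κ Φ t p D c mk) := by
    funext i; unfold ChainPlanar.BridgePrm.core1Lo Skelφ.bridgeTrSide
    fin_cases i <;> simp [Skelφ.pt]
  have hhi : (Skelφ.bridgeTrSide σ (nL κ Φ t p D g f) (hL κ Φ t p D g f) (ℓL κ Φ t p D g f) (KS0.R'0 κ Φ t p D mk) (nBF κ Φ t p D c mk) (hBF κ Φ t p D c mk) (ℓBF κ Φ t p D c mk)).core1Hi =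
      Skelφ.pt ((nL κ Φ t p D g f : ℤ) + KS0.R'0 κ Φ t p D mk + (|hBF κ Φ t p D c mk| + ℓBF κ Φ t p D c mk)) (σ * hL κ Φ t p D g f + ℓL κ Φ t p D g f + KS0.R'0 κ Φ t p D mk + σ * sgnz (hBF κ Φ t p D c mk) * nBF κ Φ t p D c mk) := by
    funext i; unfold ChainPlanar.BridgePrm.core1Hi Skelφ.bridgeTrSide
    fin_cases i <;> simp [Skelφ.pt]
  rw [hlo, hhi, Skelφ.mem_Icc_pt_iff]

/-- Core `1` of `bridgeTrTop` in coordinates. [folklore] -/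
theorem mem_core1XF_top_iff (κ : Consts) {V : Type} [DecidableEq V] [Countable V] {G : SimpleGraph V} [G.LocallyFinite] (Φ : PlanarSkeletonFrm G) (t : V) (p : unitInterval) (D : Skelφ.StepI.DataNS V) (c : ℕ) (mk : ℕ) (g : ℕ) (f : ℕ) (σ : ℤ) (x : Site 2) :
    x ∈ Finset.Icc (Skelφ.bridgeTrTop σ (nL κ Φ t p D g f) (hL κ Φ t p D g f) (ℓL κ Φ t p D g f) (KS0.R'0 κ Φ t p D mk) (nBF κ Φ t p D c mk) (hBF κ Φ t p D c mk) (ℓBF κ Φ t p D c mk)).core1Lo (Skelφ.bridgeTrTop σ (nL κ Φ t p D g f) (hL κ Φ t p D g f) (ℓL κ Φ t p D g f) (KS0.R'0 κ Φ t p D mk) (nBF κ Φ t p D c mk) (hBF κ Φ t p D c mk) (ℓBF κ Φ t p D c mk)).core1Hi ↔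
      ((nL κ Φ t p D g f : ℤ) - KS0.R'0 κ Φ t p D mk + ((ℓBF κ Φ t p D c mk : ℤ) - |hBF κ Φ t p D c mk| - 11) ≤ x 0 ∧ x 0 ≤ (nL κ Φ t p D g f : ℤ) + KS0.R'0 κ Φ t p D mk + ((ℓBF κ Φ t p D c mk : ℤ) + |hBF κ Φ t p D c mk|)) ∧
        (σ * hL κ Φ t p D g f - KS0.R'0 κ Φ t p D mk + -(nBF κ Φ t p D c mk : ℤ) ≤ x 1 ∧ x 1 ≤ σ * hL κ Φ t p D g f + ℓL κ Φ t p D g f + KS0.R'0 κ Φ t p D mk + nBF κ Φ t p D c mk) := by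
  have hlo : (Skelφ.bridgeTrTop σ (nL κ Φ t p D g f) (hL κ Φ t p D g f) (ℓL κ Φ t p D g f) (KS0.R'0 κ Φ t p D mk) (nBF κ Φ t p D c mk) (hBF κ Φ t p D c mk) (ℓBF κ Φ t p D c mk)).core1Lo =
      Skelφ.pt ((nL κ Φ t p D g f : ℤ) - KS0.R'0 κ Φ t p D mk + ((ℓBF κ Φ t p D c mk : ℤ) - |hBF κ Φ t p D c mk| - 11)) (σ * hL κ Φ t p D g f - KS0.R'0 κ Φ t p D mk + -(nBF κ Φ t p D c mk : ℤ)) := by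
    funext i; unfold ChainPlanar.BridgePrm.core1Lo Skelφ.bridgeTrTop
    fin_cases i <;> simp [Skelφ.pt]
  have hhi : (Skelφ.bridgeTrTop σ (nL κ Φ t p D g f) (hL κ Φ t p D g f) (ℓL κ Φ t p D g f) (KS0.R'0 κ Φ t p D mk) (nBF κ Φ t p D c mk) (hBF κ Φ t p D c mk) (ℓBF κ Φ t p D c mk)).core1Hi =
      Skelφ.pt ((nL κ Φ t p D g f : ℤ) + KS0.R'0 κ Φ t p D mk + ((ℓBF κ Φ t p D c mk : ℤ) + |hBF κ Φ t p D c mk|)) (σ * hL κ Φ t p D g f + ℓL κ Φ t p D g f + KS0.R'0 κ Φ t p D mk + nBF κ Φ t p D c mk) := by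
    funext i; unfold ChainPlanar.BridgePrm.core1Hi Skelφ.bridgeTrTop
    fin_cases i <;> simp [Skelφ.pt]
  rw [hlo, hhi, Skelφ.mem_Icc_pt_iff]

/-- **`hxa`, steep case.** [folklore] -/
theorem hxaXF_d (κ : Consts) {V : Type} [DecidableEq V] [Countable V] {G : SimpleGraph V} [G.LocallyFinite] (Φ : PlanarSkeletonFrm G) (t : V) (p : unitInterval) (D : Skelφ.StepI.DataNS V) (c : ℕ) (mk : ℕ) (g : ℕ) (f : ℕ) {σ : ℤ} (hσ : σ = 1 ∨ σ = -1) :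
    ∀ x ∈ Finset.Icc (Skelφ.bridgeTrSide σ (nL κ Φ t p D g f) (hL κ Φ t p D g f) (ℓL κ Φ t p D g f) (KS0.R'0 κ Φ t p D mk) (nBF κ Φ t p D c mk) (hBF κ Φ t p D c mk) (ℓBF κ Φ t p D c mk)).core1Lo (Skelφ.bridgeTrSide σ (nL κ Φ t p D g f) (hL κ Φ t p D g f) (ℓL κ Φ t p D g f) (KS0.R'0 κ Φ t p D mk) (nBF κ Φ t p D c mk) (hBF κ Φ t p D c mk) (ℓBF κ Φ t p D c mk)).core1Hi, |x 0 - σ * yLXFd κ Φ t p D c mk g f σ 0| ≤ (qBXFd κ Φ t p D c mk : ℤ) := by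
  intro x hx
  rw [mem_core1XF_side_iff] at hx
  have hσsq : σ * σ = 1 := by rcases hσ with h | h <;> simp [h]
  have e : σ * yLXFd κ Φ t p D c mk g f σ 0 = (nL κ Φ t p D g f : ℤ) + d0XFd κ Φ t p D c mk := by
    unfold yLXFd yLof; rw [Skelφ.pt_zero, ← mul_assoc, hσsq, one_mul]
  obtain ⟨d1, d2⟩ := PlanarSkeletonNeg.NegB.RootArith.floor_sandwich (x := 2 * |hBF κ Φ t p D c mk| + (ℓBF κ Φ t p D c mk : ℤ)) (d := 2) (by norm_num)
  have ed : d0XFd κ Φ t p D c mk = (2 * |hBF κ Φ t p D c mk| + (ℓBF κ Φ t p D c mk : ℤ)) / 2 := rfl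
  rw [← ed] at d1 d2
  have hq : (qBXFd κ Φ t p D c mk : ℤ) = KS0.R'0 κ Φ t p D mk + ((ℓBF κ Φ t p D c mk / 2 : ℕ) : ℤ) + 1 := by unfold qBXFd; push_cast; ring
  have hl2 := Nat.lt_div_mul_add (a := ℓBF κ Φ t p D c mk) (b := 2) (by norm_num)
  have hl2' : ((ℓBF κ Φ t p D c mk : ℕ) : ℤ) < ((ℓBF κ Φ t p D c mk / 2 : ℕ) : ℤ) * 2 + 2 := by exact_mod_cast hl2
  rw [e, hq, abs_le]; constructor <;> linarith [hx.1.1, hx.1.2]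

/-- **`hxa`, flat case.** [folklore] -/
theorem hxaXF_t (κ : Consts) {V : Type} [DecidableEq V] [Countable V] {G : SimpleGraph V} [G.LocallyFinite] (Φ : PlanarSkeletonFrm G) (t : V) (p : unitInterval) (D : Skelφ.StepI.DataNS V) (c : ℕ) (mk : ℕ) (g : ℕ) (f : ℕ) {σ : ℤ} (hσ : σ = 1 ∨ σ = -1) :
    ∀ x ∈ Finset.Icc (Skelφ.bridgeTrTop σ (nL κ Φ t p D g f) (hL κ Φ t p D g f) (ℓL κ Φ t p D g f) (KS0.R'0 κ Φ t p D mk) (nBF κ Φ t p D c mk) (hBF κ Φ t p D c mk) (ℓBF κ Φ t p D c mk)).core1Lo (Skelφ.bridgeTrTop σ (nL κ Φ t p D g f) (hL κ Φ t p D g f) (ℓL κ Φ t p D g f) (KS0.R'0 κ Φ t p D mk) (nBF κ Φ t p D c mk) (hBF κ Φ t p D c mk) (ℓBF κ Φ t p D c mk)).core1Hi, |x 0 - σ * yLXFt κ Φ t p D c mk g f σ 0| ≤ (qBXFt κ Φ t p D c mk : ℤ) := by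
  intro x hx
  rw [mem_core1XF_top_iff] at hx
  have hσsq : σ * σ = 1 := by rcases hσ with h | h <;> simp [h]
  have e : σ * yLXFt κ Φ t p D c mk g f σ 0 = (nL κ Φ t p D g f : ℤ) + ((ℓBF κ Φ t p D c mk : ℤ) - 5) := by
    unfold yLXFt yLof; rw [Skelφ.pt_zero, ← mul_assoc, hσsq, one_mul]
  have hq : (qBXFt κ Φ t p D c mk : ℤ) = KS0.R'0 κ Φ t p D mk + |hBF κ Φ t p D c mk| + 6 := by unfold qBXFt; push_cast [Int.natCast_natAbs]; ring
  rw [e, hq, abs_le]; constructor <;> linarith [hx.1.1, hx.1.2]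

/-- **p1's clearance premise `hyL`, steep case** (`2|hBF| > ℓBF ≥ 2bF + 27`, `bF = M_u + (c+2)RA′ + 1`). [folklore] -/
theorem hyL_XFd (κ : Consts) {V : Type} [DecidableEq V] [Countable V] {G : SimpleGraph V} [G.LocallyFinite] (Φ : PlanarSkeletonFrm G) (t : V) (p : unitInterval) (D : Skelφ.StepI.DataNS V) (c : ℕ) (mk : ℕ) (g : ℕ) (f : ℕ) {σ : ℤ} (hσ : σ = 1 ∨ σ = -1) (hside : ℓBF κ Φ t p D c mk < 2 * (hBF κ Φ t p D c mk).natAbs) (hℓb : 2 * bF κ Φ t p D c mk + 27 ≤ ℓBF κ Φ t p D c mk) :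
    ((Mu D : ℕ) : ℤ) < σ * yLXFd κ Φ t p D c mk g f σ 0 - (qBXFd κ Φ t p D c mk : ℤ) - KS0.R'0 κ Φ t p D mk - nL κ Φ t p D g f := by
  have hσsq : σ * σ = 1 := by rcases hσ with h | h <;> simp [h]
  have e : σ * yLXFd κ Φ t p D c mk g f σ 0 = (nL κ Φ t p D g f : ℤ) + d0XFd κ Φ t p D c mk := by
    unfold yLXFd yLof; rw [Skelφ.pt_zero, ← mul_assoc, hσsq, one_mul]
  obtain ⟨d1, d2⟩ := PlanarSkeletonNeg.NegB.RootArith.floor_sandwich (x := 2 * |hBF κ Φ t p D c mk| + (ℓBF κ Φ t p D c mk : ℤ)) (d := 2) (by norm_num)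
  have ed : d0XFd κ Φ t p D c mk = (2 * |hBF κ Φ t p D c mk| + (ℓBF κ Φ t p D c mk : ℤ)) / 2 := rfl
  rw [← ed] at d1 d2
  have hq : (qBXFd κ Φ t p D c mk : ℤ) = KS0.R'0 κ Φ t p D mk + ((ℓBF κ Φ t p D c mk / 2 : ℕ) : ℤ) + 1 := by unfold qBXFd; push_cast; ring
  have hl2 : ((ℓBF κ Φ t p D c mk / 2 : ℕ) : ℤ) * 2 ≤ (ℓBF κ Φ t p D c mk : ℤ) := by exact_mod_cast Nat.div_mul_le_self (ℓBF κ Φ t p D c mk) 2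
  have h1 := (bF_facts κ Φ t p D c mk).1
  have hcr : 2 * KS0.R'0 κ Φ t p D mk ≤ (c + 2) * KS0.R'0 κ Φ t p D mk := Nat.mul_le_mul_right _ (by omega)
  have h2 : ((ℓBF κ Φ t p D c mk : ℕ) : ℤ) < 2 * |hBF κ Φ t p D c mk| := by rw [← Int.natCast_natAbs]; exact_mod_cast hside
  have h3 : ((2 * Mu D + 4 * KS0.R'0 κ Φ t p D mk + 29 : ℕ) : ℤ) ≤ (ℓBF κ Φ t p D c mk : ℤ) := by
    exact_mod_cast (by omega : 2 * Mu D + 4 * KS0.R'0 κ Φ t p D mk + 29 ≤ ℓBF κ Φ t p D c mk)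
  push_cast at h3
  rw [e, hq]; linarith

/-- **p1's clearance premise `hyL`, flat case** (`2|hBF| ≤ ℓBF`, `ℓBF ≥ 2bF + 27`). [folklore] -/
theorem hyL_XFt (κ : Consts) {V : Type} [DecidableEq V] [Countable V] {G : SimpleGraph V} [G.LocallyFinite] (Φ : PlanarSkeletonFrm G) (t : V) (p : unitInterval) (D : Skelφ.StepI.DataNS V) (c : ℕ) (mk : ℕ) (g : ℕ) (f : ℕ) {σ : ℤ} (hσ : σ = 1 ∨ σ = -1) (htop : 2 * (hBF κ Φ t p D c mk).natAbs ≤ ℓBF κ Φ t p D c mk) (hℓb : 2 * bF κ Φ t p D c mk + 27 ≤ ℓBF κ Φ t p D c mk) :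
    ((Mu D : ℕ) : ℤ) < σ * yLXFt κ Φ t p D c mk g f σ 0 - (qBXFt κ Φ t p D c mk : ℤ) - KS0.R'0 κ Φ t p D mk - nL κ Φ t p D g f := by
  have hσsq : σ * σ = 1 := by rcases hσ with h | h <;> simp [h]
  have e : σ * yLXFt κ Φ t p D c mk g f σ 0 = (nL κ Φ t p D g f : ℤ) + ((ℓBF κ Φ t p D c mk : ℤ) - 5) := by
    unfold yLXFt yLof; rw [Skelφ.pt_zero, ← mul_assoc, hσsq, one_mul]
  have hq : (qBXFt κ Φ t p D c mk : ℤ) = KS0.R'0 κ Φ t p D mk + |hBF κ Φ t p D c mk| + 6 := by unfold qBXFt; push_cast [Int.natCast_natAbs]; ring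
  have h1 := (bF_facts κ Φ t p D c mk).1
  have hcr : 2 * KS0.R'0 κ Φ t p D mk ≤ (c + 2) * KS0.R'0 κ Φ t p D mk := Nat.mul_le_mul_right _ (by omega)
  have h2 : 2 * |hBF κ Φ t p D c mk| ≤ (ℓBF κ Φ t p D c mk : ℤ) := by rw [← Int.natCast_natAbs]; exact_mod_cast htop
  have h3 : ((2 * Mu D + 4 * KS0.R'0 κ Φ t p D mk + 29 : ℕ) : ℤ) ≤ (ℓBF κ Φ t p D c mk : ℤ) := by
    exact_mod_cast (by omega : 2 * Mu D + 4 * KS0.R'0 κ Φ t p D mk + 29 ≤ ℓBF κ Φ t p D c mk)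
  push_cast at h3
  rw [e, hq]; linarith

end Defs

/-! ## §4 At the `T` slots: widths, sizes, start windows (cases d/t) -/

section AtT

/-- **G-fit's premise** `4·qBXFd ≤ n_L` and `4·qBXFt ≤ n_L` (`16·S_F ≤ M_L < n_L`, the (F) floor `2000·Kq·(R'0+2) ≤ n_L`). [folklore] -/
theorem four_qBXFdt_le (κ : Consts) {V : Type} [DecidableEq V] [Countable V] {G : SimpleGraph V} [G.LocallyFinite] (Φ : PlanarSkeletonFrm G) (t : V) (p : unitInterval) (D : Skelφ.StepI.DataNS V) (c : ℕ) (mk : ℕ) (gx : Neg.FSlot) (fx : Neg.FSlot) (hS : 16 * SF κ Φ t p D c mk ≤ ML κ Φ t p D (gT mk gx κ Φ t p D)) (hnA : 2000 * Neg.Kq κ * (KS0.R'0 κ Φ t p D mk + 2) ≤ nL κ Φ t p D (gT mk gx κ Φ t p D) (fT mk fx κ Φ t p D)) :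
    4 * qBXFd κ Φ t p D c mk ≤ nL κ Φ t p D (gT mk gx κ Φ t p D) (fT mk fx κ Φ t p D) ∧ 4 * qBXFt κ Φ t p D c mk ≤ nL κ Φ t p D (gT mk gx κ Φ t p D) (fT mk fx κ Φ t p D) := by
  have h1 : 2000 * (KS0.R'0 κ Φ t p D mk + 2) ≤ nL κ Φ t p D (gT mk gx κ Φ t p D) (fT mk fx κ Φ t p D) := by
    have hq := Neg.one_le_Kq κ
    have := Nat.le_mul_of_pos_left (KS0.R'0 κ Φ t p D mk + 2) hq
    nlinarith [hnA, this]
  have h2 := hS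
  unfold SF at h2
  have h3 : ML κ Φ t p D (gT mk gx κ Φ t p D) + 1 ≤ nL κ Φ t p D (gT mk gx κ Φ t p D) (fT mk fx κ Φ t p D) := by have := (ML_lt_nL κ Φ t p D (gT mk gx κ Φ t p D) (fT mk fx κ Φ t p D)).1; omega
  have h4 := Nat.div_le_self (ℓBF κ Φ t p D c mk) 2
  unfold qBXFd qBXFt; constructor <;> omega

/-- **The functional sizes of the three origins**: `|Λ₀| ≤ 3m`, `|Λ₁| ≤ 2m` (the displacements are `≤ S`, the midpoints `≤ (ℓ_L + S)/2`; flat/steep need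
`27 ≤ ℓ_b`). [folklore] -/

theorem Λ_XFsdt (κ : Consts) {V : Type} [DecidableEq V] [Countable V] {G : SimpleGraph V} [G.LocallyFinite] (Φ : PlanarSkeletonFrm G) (t : V) (p : unitInterval) (D : Skelφ.StepI.DataNS V) (c : ℕ) (mk : ℕ) (gx : Neg.FSlot) (fx : Neg.FSlot) (hN : EqNumL κ Φ t p D (gT mk gx κ Φ t p D) (fT mk fx κ Φ t p D)) (hκ : (hL κ Φ t p D (gT mk gx κ Φ t p D) (fT mk fx κ Φ t p D)).natAbs ≤ 10 * nL κ Φ t p D (gT mk gx κ Φ t p D) (fT mk fx κ Φ t p D))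
    (hS : 16 * SF κ Φ t p D c mk ≤ ML κ Φ t p D (gT mk gx κ Φ t p D)) (hR0 : 22000 * (KS0.R'0 κ Φ t p D mk + 2) ≤ ML κ Φ t p D (gT mk gx κ Φ t p D)) {σ : ℤ} (hσ : σ = 1 ∨ σ = -1) (hℓb : 27 ≤ ℓBF κ Φ t p D c mk) :
    (|Λ₀of κ Φ t p D (gT mk gx κ Φ t p D) (fT mk fx κ Φ t p D) (yLXFs κ Φ t p D c mk (gT mk gx κ Φ t p D) (fT mk fx κ Φ t p D) σ)| ≤ 3 * modulus (nL κ Φ t p D (gT mk gx κ Φ t p D) (fT mk fx κ Φ t p D)) (hL κ Φ t p D (gT mk gx κ Φ t p D) (fT mk fx κ Φ t p D)) (vL κ Φ t p D (gT mk gx κ Φ t p D) (fT mk fx κ Φ t p D)) (Skelφ.NegPrm.vβOf (nL κ Φ t p D (gT mk gx κ Φ t p D) (fT mk fx κ Φ t p D)) (hL κ Φ t p D (gT mk gx κ Φ t p D) (fT mk fx κ Φ t p D)) (ℓL κ Φ t p D (gT mk gx κ Φ t p D) (fT mk fx κ Φ t p D)) (vL κ Φ t p D (gT mk gx κ Φ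 t p D) (fT mk fx κ Φ t p D))) ∧ |Λ₁of κ Φ t p D (gT mk gx κ Φ t p D) (fT mk fx κ Φ t p D) (yLXFs κ Φ t p D c mk (gT mk gx κ Φ t p D) (fT mk fx κ Φ t p D) σ)| ≤ 2 * modulus (nL κ Φ t p D (gT mk gx κ Φ t p D) (fT mk fx κ Φ t p D)) (hL κ Φ t p D (gT mk gx κ Φ t p D) (fT mk fx κ Φ t p D)) (vL κ Φ t p D (gT mk gx κ Φ t p D) (fT mk fx κ Φ t p D)) (Skelφ.NegPrm.vβOf (nL κ Φ t p D (gT mk gx κ Φ t p D) (fT mk fx κ Φ t p D)) (hL κ Φ t p D (gT mk gx κ Φ t p D) (fT mk fx κ Φ t p D)) (ℓL κ Φ t p D (gT mk gx κ Φ t p D) (fT mk fx κ Φ t p D)) (vL κ Φ t p D (gT mk gx κ Φ t p D) (fT mk fx κ Φ t p D)))) ∧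
    (|Λ₀of κ Φ t p D (gT mk gx κ Φ t p D) (fT mk fx κ Φ t p D) (yLXFd κ Φ t p D c mk (gT mk gx κ Φ t p D) (fT mk fx κ Φ t p D) σ)| ≤ 3 * modulus (nL κ Φ t p D (gT mk gx κ Φ t p D) (fT mk fx κ Φ t p D)) (hL κ Φ t p D (gT mk gx κ Φ t p D) (fT mk fx κ Φ t p D)) (vL κ Φ t p D (gT mk gx κ Φ t p D) (fT mk fx κ Φ t p D)) (Skelφ.NegPrm.vβOf (nL κ Φ t p D (gT mk gx κ Φ t p D) (fT mk fx κ Φ t p D)) (hL κ Φ t p D (gT mk gx κ Φ t p D) (fT mk fx κ Φ t p D)) (ℓL κ Φ t p D (gT mk gx κ Φ t p D) (fT mk fx κ Φ t p D)) (vL κ Φ t p D (gT mk gx κ Φ t p D) (fT mk fx κ Φ t p D))) ∧ |Λ₁of κ Φ t p D (gT mk gx κ Φ t p D) (fT mk fx κ Φ t p D) (yLXFd κ Φ t p D c mk (gT mk gx κ Φ t p D) (fT mk fx κ Φ t p D) σ)| ≤ 2 * modulus (nL κ Φ t p D (gT mk gx κ Φ t p D) (fT mk fx κ Φ t p D)) (hL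 κ Φ t p D (gT mk gx κ Φ t p D) (fT mk fx κ Φ t p D)) (vL κ Φ t p D (gT mk gx κ Φ t p D) (fT mk fx κ Φ t p D)) (Skelφ.NegPrm.vβOf (nL κ Φ t p D (gT mk gx κ Φ t p D) (fT mk fx κ Φ t p D)) (hL κ Φ t p D (gT mk gx κ Φ t p D) (fT mk fx κ Φ t p D)) (ℓL κ Φ t p D (gT mk gx κ Φ t p D) (fT mk fx κ Φ t p D)) (vL κ Φ t p D (gT mk gx κ Φ t p D) (fT mk fx κ Φ t p D)))) ∧
    (|Λ₀of κ Φ t p D (gT mk gx κ Φ t p D) (fT mk fx κ Φ t p D) (yLXFt κ Φ t p D c mk (gT mk gx κ Φ t p D) (fT mk fx κ Φ t p D) σ)| ≤ 3 * modulus (nL κ Φ t p D (gT mk gx κ Φ t p D) (fT mk fx κ Φ t p D)) (hL κ Φ t p D (gT mk gx κ Φ t p D) (fT mk fx κ Φ t p D)) (vL κ Φ t p D (gT mk gx κ Φ t p D) (fT mk fx κ Φ t p D)) (Skelφ.NegPrm.vβOf (nL κ Φ t p D (gT mk gx κ Φ t p D) (fT mk fx κ Φ t p D)) (hL κ Φ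 t p D (gT mk gx κ Φ t p D) (fT mk fx κ Φ t p D)) (ℓL κ Φ t p D (gT mk gx κ Φ t p D) (fT mk fx κ Φ t p D)) (vL κ Φ t p D (gT mk gx κ Φ t p D) (fT mk fx κ Φ t p D))) ∧ |Λ₁of κ Φ t p D (gT mk gx κ Φ t p D) (fT mk fx κ Φ t p D) (yLXFt κ Φ t p D c mk (gT mk gx κ Φ t p D) (fT mk fx κ Φ t p D) σ)| ≤ 2 * modulus (nL κ Φ t p D (gT mk gx κ Φ t p D) (fT mk fx κ Φ t p D)) (hL κ Φ t p D (gT mk gx κ Φ t p D) (fT mk fx κ Φ t p D)) (vL κ Φ t p D (gT mk gx κ Φ t p D) (fT mk fx κ Φ t p D)) (Skelφ.NegPrm.vβOf (nL κ Φ t p D (gT mk gx κ Φ t p D) (fT mk fx κ Φ t p D)) (hL κ Φ t p D (gT mk gx κ Φ t p D) (fT mk fx κ Φ t p D)) (ℓL κ Φ t p D (gT mk gx κ Φ t p D) (fT mk fx κ Φ t p D)) (vL κ Φ t p D (gT mk gx κ Φ t p D) (fT mk fx κ Φ t p D)))) := by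
  have hS0 : (0 : ℤ) ≤ ((SF κ Φ t p D c mk : ℕ) : ℤ) := by positivity
  have eS : ((SF κ Φ t p D c mk : ℕ) : ℤ) = (nBF κ Φ t p D c mk : ℤ) + ℓBF κ Φ t p D c mk + |hBF κ Φ t p D c mk| := by unfold SF; push_cast [Int.natCast_natAbs]; ring
  have hℓL : (0 : ℤ) ≤ (ℓL κ Φ t p D (gT mk gx κ Φ t p D) (fT mk fx κ Φ t p D) : ℤ) := by positivity
  have hℓb' : (27 : ℤ) ≤ ℓBF κ Φ t p D c mk := by exact_mod_cast hℓb
  obtain ⟨l1, l2⟩ := PlanarSkeletonNeg.NegB.RootArith.floor_sandwich (x := (ℓL κ Φ t p D (gT mk gx κ Φ t p D) (fT mk fx κ Φ t p D) : ℤ)) (d := 2) (by norm_num)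
  refine ⟨?_, ?_, ?_⟩
  · -- same: d₀ = n_b, d₁ = h_b, mh = ⌊(ℓ_L+ℓ_b)/2⌋
    obtain ⟨m1, m2⟩ := PlanarSkeletonNeg.NegB.RootArith.floor_sandwich (x := (ℓL κ Φ t p D (gT mk gx κ Φ t p D) (fT mk fx κ Φ t p D) : ℤ) + ℓBF κ Φ t p D c mk) (d := 2) (by norm_num)
    refine abs_Λof_yLofF_le κ Φ t p D c mk gx (fT mk fx κ Φ t p D) hN hκ hS hR0 hσ ?_ ?_ ?_ ?_
    · rw [eS, Nat.abs_cast]; linarith [abs_nonneg (hBF κ Φ t p D c mk)]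
    · rw [eS]; linarith
    · show (0 : ℤ) ≤ mhXFs κ Φ t p D c mk (gT mk gx κ Φ t p D) (fT mk fx κ Φ t p D); unfold mhXFs; omega
    · show 2 * mhXFs κ Φ t p D c mk (gT mk gx κ Φ t p D) (fT mk fx κ Φ t p D) ≤ _; unfold mhXFs; rw [eS]; linarith [abs_nonneg (hBF κ Φ t p D c mk)]
  · -- steep: d₀ = ⌊(2|h_b|+ℓ_b)/2⌋, d₁ = sgnz h_b · n_b, mh = ⌊ℓ_L/2⌋
    obtain ⟨d1, d2⟩ := PlanarSkeletonNeg.NegB.RootArith.floor_sandwich (x := 2 * |hBF κ Φ t p D c mk| + (ℓBF κ Φ t p D c mk : ℤ)) (d := 2) (by norm_num)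
    have hs : |sgnz (hBF κ Φ t p D c mk)| = 1 := by rcases sgnz_cases (hBF κ Φ t p D c mk) with h | h <;> simp [h]
    refine abs_Λof_yLofF_le κ Φ t p D c mk gx (fT mk fx κ Φ t p D) hN hκ hS hR0 hσ ?_ ?_ ?_ ?_
    · show |d0XFd κ Φ t p D c mk| ≤ _
      unfold d0XFd; rw [eS, abs_le]; constructor <;> linarith [abs_nonneg (hBF κ Φ t p D c mk)]
    · rw [abs_mul, hs, one_mul, Nat.abs_cast, eS]; linarith [abs_nonneg (hBF κ Φ t p D c mk)]
    · omega
    · linarith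
  · -- flat: d₀ = ℓ_b − 5, d₁ = 0, mh = ⌊ℓ_L/2⌋
    refine abs_Λof_yLofF_le κ Φ t p D c mk gx (fT mk fx κ Φ t p D) hN hκ hS hR0 hσ ?_ ?_ ?_ ?_
    · rw [eS, abs_le]; constructor <;> linarith [abs_nonneg (hBF κ Φ t p D c mk)]
    · simp only [abs_zero]; exact hS0
    · omega
    · linarith

/-- **`hxb`, steep case** (`22RA′ + 10ℓ_b + 43 ≤ ℓ_L`). [folklore] -/
theorem hxbXF_d (κ : Consts) {V : Type} [DecidableEq V] [Countable V] {G : SimpleGraph V} [G.LocallyFinite] (Φ : PlanarSkeletonFrm G) (t : V) (p : unitInterval) (D : Skelφ.StepI.DataNS V) (c : ℕ) (mk : ℕ) (gx : Neg.FSlot) (fx : Neg.FSlot) (hN : EqNumL κ Φ t p D (gT mk gx κ Φ t p D) (fT mk fx κ Φ t p D)) (hκ : (hL κ Φ t p D (gT mk gx κ Φ t p D) (fT mk fx κ Φ t p D)).natAbs ≤ 10 * nL κ Φ t p D (gT mk gx κ Φ t p D) (fT mk fx κ Φ t p D)) (hS : 16 * SF κ Φ t p D c mk ≤ ML κ Φ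 t p D (gT mk gx κ Φ t p D)) (hR0 : 22000 * (KS0.R'0 κ Φ t p D mk + 2) ≤ ML κ Φ t p D (gT mk gx κ Φ t p D)) {σ : ℤ} (hσ : σ = 1 ∨ σ = -1) :
    ∀ x ∈ Finset.Icc (Skelφ.bridgeTrSide σ (nL κ Φ t p D (gT mk gx κ Φ t p D) (fT mk fx κ Φ t p D)) (hL κ Φ t p D (gT mk gx κ Φ t p D) (fT mk fx κ Φ t p D)) (ℓL κ Φ t p D (gT mk gx κ Φ t p D) (fT mk fx κ Φ t p D)) (KS0.R'0 κ Φ t p D mk) (nBF κ Φ t p D c mk) (hBF κ Φ t p D c mk) (ℓBF κ Φ t p D c mk)).core1Lo (Skelφ.bridgeTrSide σ (nL κ Φ t p D (gT mk gx κ Φ t p D) (fT mk fx κ Φ t p D)) (hL κ Φ t p D (gT mk gx κ Φ t p D) (fT mk fx κ Φ t p D)) (ℓL κ Φ t p D (gT mk gx κ Φ t p D) (fT mk fx κ Φ t p D)) (KS0.R'0 κ Φ t p D mk) (nBF κ Φ t p D c mk) (hBF κ Φ t p D c mk) (ℓBF κ Φ t p D c mk)).core1Hi,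
      |σ * ((nL κ Φ t p D (gT mk gx κ Φ t p D) (fT mk fx κ Φ t p D) : ℤ) * (x 1 - yLXFd κ Φ t p D c mk (gT mk gx κ Φ t p D) (fT mk fx κ Φ t p D) σ 1) - hL κ Φ t p D (gT mk gx κ Φ t p D) (fT mk fx κ Φ t p D) * (σ * x 0 - yLXFd κ Φ t p D c mk (gT mk gx κ Φ t p D) (fT mk fx κ Φ t p D) σ 0))| + (shearUnit (nL κ Φ t p D (gT mk gx κ Φ t p D) (fT mk fx κ Φ t p D)) (hL κ Φ t p D (gT mk gx κ Φ t p D) (fT mk fx κ Φ t p D)) : ℤ) ≤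
        ((nL κ Φ t p D (gT mk gx κ Φ t p D) (fT mk fx κ Φ t p D) * ℓL κ Φ t p D (gT mk gx κ Φ t p D) (fT mk fx κ Φ t p D) / shearUnit (nL κ Φ t p D (gT mk gx κ Φ t p D) (fT mk fx κ Φ t p D)) (hL κ Φ t p D (gT mk gx κ Φ t p D) (fT mk fx κ Φ t p D)) + 1 : ℕ) : ℤ) * (shearUnit (nL κ Φ t p D (gT mk gx κ Φ t p D) (fT mk fx κ Φ t p D)) (hL κ Φ t p D (gT mk gx κ Φ t p D) (fT mk fx κ Φ t p D)) : ℤ) := by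
  intro x hx
  rw [mem_core1XF_side_iff] at hx
  obtain ⟨⟨h0l, h0u⟩, ⟨h1l, h1u⟩⟩ := hx
  obtain ⟨hn1, hℓ1⟩ := one_le_of_eqNumL κ Φ t p D _ _ hN
  have hσabs : |σ| = 1 := by rcases hσ with h | h <;> simp [h]
  -- the floor
  have hfl : 22 * (KS0.R'0 κ Φ t p D mk : ℤ) + 10 * ℓBF κ Φ t p D c mk + 43 ≤ ℓL κ Φ t p D (gT mk gx κ Φ t p D) (fT mk fx κ Φ t p D) := by
    have h3 := hS
    unfold SF at h3
    have h4 : 22000 * (KS0.R'0 κ Φ t p D mk + 2) ≤ ML κ Φ t p D (gT mk gx κ Φ t p D) := hR0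
    have h5 := hN.ℓ_le
    have h6 : ((22 * KS0.R'0 κ Φ t p D mk + 10 * ℓBF κ Φ t p D c mk + 43 : ℕ) : ℤ) ≤ (ML κ Φ t p D (gT mk gx κ Φ t p D) : ℤ) := by
      exact_mod_cast (by omega : 22 * KS0.R'0 κ Φ t p D mk + 10 * ℓBF κ Φ t p D c mk + 43 ≤ ML κ Φ t p D (gT mk gx κ Φ t p D))
    push_cast at h6; linarith
  have e0 : σ * x 0 - yLXFd κ Φ t p D c mk (gT mk gx κ Φ t p D) (fT mk fx κ Φ t p D) σ 0 = σ * (x 0 - ((nL κ Φ t p D (gT mk gx κ Φ t p D) (fT mk fx κ Φ t p D) : ℤ) + d0XFd κ Φ t p D c mk)) := by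
    unfold yLXFd yLof; rw [Skelφ.pt_zero]; ring
  have e1 : yLXFd κ Φ t p D c mk (gT mk gx κ Φ t p D) (fT mk fx κ Φ t p D) σ 1 = σ * (hL κ Φ t p D (gT mk gx κ Φ t p D) (fT mk fx κ Φ t p D) + sgnz (hBF κ Φ t p D c mk) * nBF κ Φ t p D c mk) + (ℓL κ Φ t p D (gT mk gx κ Φ t p D) (fT mk fx κ Φ t p D) : ℤ) / 2 := by
    unfold yLXFd yLof; rw [Skelφ.pt_one]
  obtain ⟨l1, l2⟩ := PlanarSkeletonNeg.NegB.RootArith.floor_sandwich (x := (ℓL κ Φ t p D (gT mk gx κ Φ t p D) (fT mk fx κ Φ t p D) : ℤ)) (d := 2) (by norm_num)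
  obtain ⟨d1, d2⟩ := PlanarSkeletonNeg.NegB.RootArith.floor_sandwich (x := 2 * |hBF κ Φ t p D c mk| + (ℓBF κ Φ t p D c mk : ℤ)) (d := 2) (by norm_num)
  have ed : d0XFd κ Φ t p D c mk = (2 * |hBF κ Φ t p D c mk| + (ℓBF κ Φ t p D c mk : ℤ)) / 2 := rfl
  rw [← ed] at d1 d2
  have hq : (qBXFd κ Φ t p D c mk : ℤ) = KS0.R'0 κ Φ t p D mk + ((ℓBF κ Φ t p D c mk / 2 : ℕ) : ℤ) + 1 := by unfold qBXFd; push_cast; ring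
  have hl2' : ((ℓBF κ Φ t p D c mk : ℕ) : ℤ) < ((ℓBF κ Φ t p D c mk / 2 : ℕ) : ℤ) * 2 + 2 := by exact_mod_cast Nat.lt_div_mul_add (a := ℓBF κ Φ t p D c mk) (b := 2) (by norm_num)
  have hl2 : ((ℓBF κ Φ t p D c mk / 2 : ℕ) : ℤ) * 2 ≤ (ℓBF κ Φ t p D c mk : ℤ) := by exact_mod_cast Nat.div_mul_le_self (ℓBF κ Φ t p D c mk) 2
  set a := x 1 - yLXFd κ Φ t p D c mk (gT mk gx κ Φ t p D) (fT mk fx κ Φ t p D) σ 1 with ha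
  set b := x 0 - ((nL κ Φ t p D (gT mk gx κ Φ t p D) (fT mk fx κ Φ t p D) : ℤ) + d0XFd κ Φ t p D c mk) with hb
  set T2 := (ℓL κ Φ t p D (gT mk gx κ Φ t p D) (fT mk fx κ Φ t p D) : ℤ) + 2 * KS0.R'0 κ Φ t p D mk + 1 with hT2
  set Q := (KS0.R'0 κ Φ t p D mk : ℤ) + ℓBF κ Φ t p D c mk / 2 + 1 with hQ
  have hQ' : (ℓBF κ Φ t p D c mk : ℤ) / 2 ≤ ((ℓBF κ Φ t p D c mk / 2 : ℕ) : ℤ) + 0 := by omega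
  have hb' : |b| ≤ Q := abs_le.2 ⟨by omega, by omega⟩
  have ha' : |2 * a| ≤ T2 := by rw [ha, e1, hT2, abs_le]; constructor <;> linarith
  have hfl : (2 * KS0.R'0 κ Φ t p D mk + 1 : ℤ) + 20 * Q + 22 ≤ ℓL κ Φ t p D (gT mk gx κ Φ t p D) (fT mk fx κ Φ t p D) := by rw [hQ]; omega
  rw [e0]
  have hU : (shearUnit (nL κ Φ t p D (gT mk gx κ Φ t p D) (fT mk fx κ Φ t p D)) (hL κ Φ t p D (gT mk gx κ Φ t p D) (fT mk fx κ Φ t p D)) : ℤ) ≤ 11 * (nL κ Φ t p D (gT mk gx κ Φ t p D) (fT mk fx κ Φ t p D) : ℤ) := by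
    have h10 : ((hL κ Φ t p D (gT mk gx κ Φ t p D) (fT mk fx κ Φ t p D)).natAbs : ℤ) ≤ 10 * (nL κ Φ t p D (gT mk gx κ Φ t p D) (fT mk fx κ Φ t p D) : ℤ) := by exact_mod_cast hκ
    unfold Skelφ.shearUnit; simp only [Nat.cast_add]; linarith
  have hκ' : |hL κ Φ t p D (gT mk gx κ Φ t p D) (fT mk fx κ Φ t p D)| ≤ 10 * (nL κ Φ t p D (gT mk gx κ Φ t p D) (fT mk fx κ Φ t p D) : ℤ) := by rw [← Int.natCast_natAbs]; exact_mod_cast hκ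
  have key : |σ * ((nL κ Φ t p D (gT mk gx κ Φ t p D) (fT mk fx κ Φ t p D) : ℤ) * a - hL κ Φ t p D (gT mk gx κ Φ t p D) (fT mk fx κ Φ t p D) * (σ * b))| ≤ (nL κ Φ t p D (gT mk gx κ Φ t p D) (fT mk fx κ Φ t p D) : ℤ) * |a| + |hL κ Φ t p D (gT mk gx κ Φ t p D) (fT mk fx κ Φ t p D)| * |b| := by
    rw [abs_mul, hσabs, one_mul]
    calc |(nL κ Φ t p D (gT mk gx κ Φ t p D) (fT mk fx κ Φ t p D) : ℤ) * a - hL κ Φ t p D (gT mk gx κ Φ t p D) (fT mk fx κ Φ t p D) * (σ * b)| ≤ |(nL κ Φ t p D (gT mk gx κ Φ t p D) (fT mk fx κ Φ t p D) : ℤ) * a| + |hL κ Φ t p D (gT mk gx κ Φ t p D) (fT mk fx κ Φ t p D) * (σ * b)| := abs_sub _ _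
      _ = (nL κ Φ t p D (gT mk gx κ Φ t p D) (fT mk fx κ Φ t p D) : ℤ) * |a| + |hL κ Φ t p D (gT mk gx κ Φ t p D) (fT mk fx κ Φ t p D)| * |b| := by rw [abs_mul, abs_mul, abs_mul, hσabs, one_mul, Nat.abs_cast]
  have hn0 : (0 : ℤ) ≤ nL κ Φ t p D (gT mk gx κ Φ t p D) (fT mk fx κ Φ t p D) := by positivity
  have h2a : 2 * ((nL κ Φ t p D (gT mk gx κ Φ t p D) (fT mk fx κ Φ t p D) : ℤ) * |a|) ≤ (nL κ Φ t p D (gT mk gx κ Φ t p D) (fT mk fx κ Φ t p D) : ℤ) * T2 := by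
    have : (nL κ Φ t p D (gT mk gx κ Φ t p D) (fT mk fx κ Φ t p D) : ℤ) * |2 * a| ≤ (nL κ Φ t p D (gT mk gx κ Φ t p D) (fT mk fx κ Φ t p D) : ℤ) * T2 := mul_le_mul_of_nonneg_left ha' hn0
    rw [abs_mul, show |(2:ℤ)| = 2 by norm_num] at this; linarith
  have h2b : |hL κ Φ t p D (gT mk gx κ Φ t p D) (fT mk fx κ Φ t p D)| * |b| ≤ 10 * (nL κ Φ t p D (gT mk gx κ Φ t p D) (fT mk fx κ Φ t p D) : ℤ) * Q := mul_le_mul hκ' hb' (abs_nonneg _) (by positivity)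
  have hfl' := mul_le_mul_of_nonneg_left hfl hn0
  have hUpos : 0 < shearUnit (nL κ Φ t p D (gT mk gx κ Φ t p D) (fT mk fx κ Φ t p D)) (hL κ Φ t p D (gT mk gx κ Φ t p D) (fT mk fx κ Φ t p D)) := by unfold Skelφ.shearUnit; omega
  have hWlo : (nL κ Φ t p D (gT mk gx κ Φ t p D) (fT mk fx κ Φ t p D) : ℤ) * ℓL κ Φ t p D (gT mk gx κ Φ t p D) (fT mk fx κ Φ t p D) + 1 ≤ ((nL κ Φ t p D (gT mk gx κ Φ t p D) (fT mk fx κ Φ t p D) * ℓL κ Φ t p D (gT mk gx κ Φ t p D) (fT mk fx κ Φ t p D) / shearUnit (nL κ Φ t p D (gT mk gx κ Φ t p D) (fT mk fx κ Φ t p D)) (hL κ Φ t p D (gT mk gx κ Φ t p D) (fT mk fx κ Φ t p D)) + 1 : ℕ) : ℤ) * (shearUnit (nL κ Φ t p D (gT mk gx κ Φ t p D) (fT mk fx κ Φ t p D)) (hL κ Φ t p D (gT mk gx κ Φ t p D) (fT mk fx κ Φ t p D)) : ℤ) := by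
    have hWlo' := Nat.lt_div_mul_add (a := nL κ Φ t p D (gT mk gx κ Φ t p D) (fT mk fx κ Φ t p D) * ℓL κ Φ t p D (gT mk gx κ Φ t p D) (fT mk fx κ Φ t p D)) hUpos
    have h' : nL κ Φ t p D (gT mk gx κ Φ t p D) (fT mk fx κ Φ t p D) * ℓL κ Φ t p D (gT mk gx κ Φ t p D) (fT mk fx κ Φ t p D) + 1 ≤ (nL κ Φ t p D (gT mk gx κ Φ t p D) (fT mk fx κ Φ t p D) * ℓL κ Φ t p D (gT mk gx κ Φ t p D) (fT mk fx κ Φ t p D) / shearUnit (nL κ Φ t p D (gT mk gx κ Φ t p D) (fT mk fx κ Φ t p D)) (hL κ Φ t p D (gT mk gx κ Φ t p D) (fT mk fx κ Φ t p D)) + 1) * shearUnit (nL κ Φ t p D (gT mk gx κ Φ t p D) (fT mk fx κ Φ t p D)) (hL κ Φ t p D (gT mk gx κ Φ t p D) (fT mk fx κ Φ t p D)) := by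
      rw [Nat.add_mul, one_mul]; omega
    exact_mod_cast h'
  have hab := abs_nonneg (σ * ((nL κ Φ t p D (gT mk gx κ Φ t p D) (fT mk fx κ Φ t p D) : ℤ) * a - hL κ Φ t p D (gT mk gx κ Φ t p D) (fT mk fx κ Φ t p D) * (σ * b)))
  linarith [key, h2a, h2b, hU, hfl', hWlo, abs_nonneg a]

/-- **`hxb`, flat case** (`22RA′ + 2n_b + 20|h_b| + 143 ≤ ℓ_L`, using `2|h_b| ≤ ℓ_b`). [folklore] -/
theorem hxbXF_t (κ : Consts) {V : Type} [DecidableEq V] [Countable V] {G : SimpleGraph V} [G.LocallyFinite] (Φ : PlanarSkeletonFrm G) (t : V) (p : unitInterval) (D : Skelφ.StepI.DataNS V) (c : ℕ) (mk : ℕ) (gx : Neg.FSlot) (fx : Neg.FSlot) (hN : EqNumL κ Φ t p D (gT mk gx κ Φ t p D) (fT mk fx κ Φ t p D)) (hκ : (hL κ Φ t p D (gT mk gx κ Φ t p D) (fT mk fx κ Φ t p D)).natAbs ≤ 10 * nL κ Φ t p D (gT mk gx κ Φ t p D) (fT mk fx κ Φ t p D)) (hS : 16 * SF κ Φ t p D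 c mk ≤ ML κ Φ t p D (gT mk gx κ Φ t p D)) (hR0 : 22000 * (KS0.R'0 κ Φ t p D mk + 2) ≤ ML κ Φ t p D (gT mk gx κ Φ t p D)) {σ : ℤ} (hσ : σ = 1 ∨ σ = -1)
    (htop : 2 * (hBF κ Φ t p D c mk).natAbs ≤ ℓBF κ Φ t p D c mk) :
    ∀ x ∈ Finset.Icc (Skelφ.bridgeTrTop σ (nL κ Φ t p D (gT mk gx κ Φ t p D) (fT mk fx κ Φ t p D)) (hL κ Φ t p D (gT mk gx κ Φ t p D) (fT mk fx κ Φ t p D)) (ℓL κ Φ t p D (gT mk gx κ Φ t p D) (fT mk fx κ Φ t p D)) (KS0.R'0 κ Φ t p D mk) (nBF κ Φ t p D c mk) (hBF κ Φ t p D c mk) (ℓBF κ Φ t p D c mk)).core1Lo (Skelφ.bridgeTrTop σ (nL κ Φ t p D (gT mk gx κ Φ t p D) (fT mk fx κ Φ t p D)) (hL κ Φ t p D (gT mk gx κ Φ t p D) (fT mk fx κ Φ t p D)) (ℓL κ Φ t p D (gT mk gx κ Φ t p D) (fT mk fx κ Φ t p D)) (KS0.R'0 κ Φ t p D mk) (nBF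 κ Φ t p D c mk) (hBF κ Φ t p D c mk) (ℓBF κ Φ t p D c mk)).core1Hi,
      |σ * ((nL κ Φ t p D (gT mk gx κ Φ t p D) (fT mk fx κ Φ t p D) : ℤ) * (x 1 - yLXFt κ Φ t p D c mk (gT mk gx κ Φ t p D) (fT mk fx κ Φ t p D) σ 1) - hL κ Φ t p D (gT mk gx κ Φ t p D) (fT mk fx κ Φ t p D) * (σ * x 0 - yLXFt κ Φ t p D c mk (gT mk gx κ Φ t p D) (fT mk fx κ Φ t p D) σ 0))| + (shearUnit (nL κ Φ t p D (gT mk gx κ Φ t p D) (fT mk fx κ Φ t p D)) (hL κ Φ t p D (gT mk gx κ Φ t p D) (fT mk fx κ Φ t p D)) : ℤ) ≤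
        ((nL κ Φ t p D (gT mk gx κ Φ t p D) (fT mk fx κ Φ t p D) * ℓL κ Φ t p D (gT mk gx κ Φ t p D) (fT mk fx κ Φ t p D) / shearUnit (nL κ Φ t p D (gT mk gx κ Φ t p D) (fT mk fx κ Φ t p D)) (hL κ Φ t p D (gT mk gx κ Φ t p D) (fT mk fx κ Φ t p D)) + 1 : ℕ) : ℤ) * (shearUnit (nL κ Φ t p D (gT mk gx κ Φ t p D) (fT mk fx κ Φ t p D)) (hL κ Φ t p D (gT mk gx κ Φ t p D) (fT mk fx κ Φ t p D)) : ℤ) := by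
  intro x hx
  rw [mem_core1XF_top_iff] at hx
  obtain ⟨⟨h0l, h0u⟩, ⟨h1l, h1u⟩⟩ := hx
  obtain ⟨hn1, hℓ1⟩ := one_le_of_eqNumL κ Φ t p D _ _ hN
  have hσabs : |σ| = 1 := by rcases hσ with h | h <;> simp [h]
  have htop' : 2 * |hBF κ Φ t p D c mk| ≤ (ℓBF κ Φ t p D c mk : ℤ) := by rw [← Int.natCast_natAbs]; exact_mod_cast htop
  have hfl : 22 * (KS0.R'0 κ Φ t p D mk : ℤ) + 2 * nBF κ Φ t p D c mk + 20 * |hBF κ Φ t p D c mk| + 143 ≤ ℓL κ Φ t p D (gT mk gx κ Φ t p D) (fT mk fx κ Φ t p D) := by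
    have h3 := hS
    unfold SF at h3
    have h4 : 22000 * (KS0.R'0 κ Φ t p D mk + 2) ≤ ML κ Φ t p D (gT mk gx κ Φ t p D) := hR0
    have h5 := hN.ℓ_le
    have h6 : ((22 * KS0.R'0 κ Φ t p D mk + 2 * nBF κ Φ t p D c mk + 10 * ℓBF κ Φ t p D c mk + 143 : ℕ) : ℤ) ≤ (ML κ Φ t p D (gT mk gx κ Φ t p D) : ℤ) := by
      exact_mod_cast (by omega : 22 * KS0.R'0 κ Φ t p D mk + 2 * nBF κ Φ t p D c mk + 10 * ℓBF κ Φ t p D c mk + 143 ≤ ML κ Φ t p D (gT mk gx κ Φ t p D))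
    push_cast at h6; linarith
  have e0 : σ * x 0 - yLXFt κ Φ t p D c mk (gT mk gx κ Φ t p D) (fT mk fx κ Φ t p D) σ 0 = σ * (x 0 - ((nL κ Φ t p D (gT mk gx κ Φ t p D) (fT mk fx κ Φ t p D) : ℤ) + ((ℓBF κ Φ t p D c mk : ℤ) - 5))) := by
    unfold yLXFt yLof; rw [Skelφ.pt_zero]; ring
  have e1 : yLXFt κ Φ t p D c mk (gT mk gx κ Φ t p D) (fT mk fx κ Φ t p D) σ 1 = σ * (hL κ Φ t p D (gT mk gx κ Φ t p D) (fT mk fx κ Φ t p D) + 0) + (ℓL κ Φ t p D (gT mk gx κ Φ t p D) (fT mk fx κ Φ t p D) : ℤ) / 2 := by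
    unfold yLXFt yLof; rw [Skelφ.pt_one]
  obtain ⟨l1, l2⟩ := PlanarSkeletonNeg.NegB.RootArith.floor_sandwich (x := (ℓL κ Φ t p D (gT mk gx κ Φ t p D) (fT mk fx κ Φ t p D) : ℤ)) (d := 2) (by norm_num)
  have hq : (qBXFt κ Φ t p D c mk : ℤ) = KS0.R'0 κ Φ t p D mk + |hBF κ Φ t p D c mk| + 6 := by unfold qBXFt; push_cast [Int.natCast_natAbs]; ring
  set a := x 1 - yLXFt κ Φ t p D c mk (gT mk gx κ Φ t p D) (fT mk fx κ Φ t p D) σ 1 with ha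
  set b := x 0 - ((nL κ Φ t p D (gT mk gx κ Φ t p D) (fT mk fx κ Φ t p D) : ℤ) + ((ℓBF κ Φ t p D c mk : ℤ) - 5)) with hb
  set T2 := (ℓL κ Φ t p D (gT mk gx κ Φ t p D) (fT mk fx κ Φ t p D) : ℤ) + 2 * KS0.R'0 κ Φ t p D mk + 2 * nBF κ Φ t p D c mk + 1 with hT2
  set Q := (KS0.R'0 κ Φ t p D mk : ℤ) + |hBF κ Φ t p D c mk| + 6 with hQ
  have hb' : |b| ≤ Q := abs_le.2 ⟨by rw [hb, hQ]; linarith, by rw [hb, hQ]; linarith⟩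
  have ha' : |2 * a| ≤ T2 := by rw [ha, e1, hT2, abs_le]; constructor <;> linarith
  have hfl : (2 * KS0.R'0 κ Φ t p D mk + 2 * nBF κ Φ t p D c mk + 1 : ℤ) + 20 * Q + 22 ≤ ℓL κ Φ t p D (gT mk gx κ Φ t p D) (fT mk fx κ Φ t p D) := by rw [hQ]; linarith
  rw [e0]
  have hU : (shearUnit (nL κ Φ t p D (gT mk gx κ Φ t p D) (fT mk fx κ Φ t p D)) (hL κ Φ t p D (gT mk gx κ Φ t p D) (fT mk fx κ Φ t p D)) : ℤ) ≤ 11 * (nL κ Φ t p D (gT mk gx κ Φ t p D) (fT mk fx κ Φ t p D) : ℤ) := by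
    have h10 : ((hL κ Φ t p D (gT mk gx κ Φ t p D) (fT mk fx κ Φ t p D)).natAbs : ℤ) ≤ 10 * (nL κ Φ t p D (gT mk gx κ Φ t p D) (fT mk fx κ Φ t p D) : ℤ) := by exact_mod_cast hκ
    unfold Skelφ.shearUnit; simp only [Nat.cast_add]; linarith
  have hκ' : |hL κ Φ t p D (gT mk gx κ Φ t p D) (fT mk fx κ Φ t p D)| ≤ 10 * (nL κ Φ t p D (gT mk gx κ Φ t p D) (fT mk fx κ Φ t p D) : ℤ) := by rw [← Int.natCast_natAbs]; exact_mod_cast hκ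
  have key : |σ * ((nL κ Φ t p D (gT mk gx κ Φ t p D) (fT mk fx κ Φ t p D) : ℤ) * a - hL κ Φ t p D (gT mk gx κ Φ t p D) (fT mk fx κ Φ t p D) * (σ * b))| ≤ (nL κ Φ t p D (gT mk gx κ Φ t p D) (fT mk fx κ Φ t p D) : ℤ) * |a| + |hL κ Φ t p D (gT mk gx κ Φ t p D) (fT mk fx κ Φ t p D)| * |b| := by
    rw [abs_mul, hσabs, one_mul]
    calc |(nL κ Φ t p D (gT mk gx κ Φ t p D) (fT mk fx κ Φ t p D) : ℤ) * a - hL κ Φ t p D (gT mk gx κ Φ t p D) (fT mk fx κ Φ t p D) * (σ * b)| ≤ |(nL κ Φ t p D (gT mk gx κ Φ t p D) (fT mk fx κ Φ t p D) : ℤ) * a| + |hL κ Φ t p D (gT mk gx κ Φ t p D) (fT mk fx κ Φ t p D) * (σ * b)| := abs_sub _ _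
      _ = (nL κ Φ t p D (gT mk gx κ Φ t p D) (fT mk fx κ Φ t p D) : ℤ) * |a| + |hL κ Φ t p D (gT mk gx κ Φ t p D) (fT mk fx κ Φ t p D)| * |b| := by rw [abs_mul, abs_mul, abs_mul, hσabs, one_mul, Nat.abs_cast]
  have hn0 : (0 : ℤ) ≤ nL κ Φ t p D (gT mk gx κ Φ t p D) (fT mk fx κ Φ t p D) := by positivity
  have h2a : 2 * ((nL κ Φ t p D (gT mk gx κ Φ t p D) (fT mk fx κ Φ t p D) : ℤ) * |a|) ≤ (nL κ Φ t p D (gT mk gx κ Φ t p D) (fT mk fx κ Φ t p D) : ℤ) * T2 := by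
    have : (nL κ Φ t p D (gT mk gx κ Φ t p D) (fT mk fx κ Φ t p D) : ℤ) * |2 * a| ≤ (nL κ Φ t p D (gT mk gx κ Φ t p D) (fT mk fx κ Φ t p D) : ℤ) * T2 := mul_le_mul_of_nonneg_left ha' hn0
    rw [abs_mul, show |(2:ℤ)| = 2 by norm_num] at this; linarith
  have h2b : |hL κ Φ t p D (gT mk gx κ Φ t p D) (fT mk fx κ Φ t p D)| * |b| ≤ 10 * (nL κ Φ t p D (gT mk gx κ Φ t p D) (fT mk fx κ Φ t p D) : ℤ) * Q := mul_le_mul hκ' hb' (abs_nonneg _) (by positivity)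
  have hfl' := mul_le_mul_of_nonneg_left hfl hn0
  have hUpos : 0 < shearUnit (nL κ Φ t p D (gT mk gx κ Φ t p D) (fT mk fx κ Φ t p D)) (hL κ Φ t p D (gT mk gx κ Φ t p D) (fT mk fx κ Φ t p D)) := by unfold Skelφ.shearUnit; omega
  have hWlo : (nL κ Φ t p D (gT mk gx κ Φ t p D) (fT mk fx κ Φ t p D) : ℤ) * ℓL κ Φ t p D (gT mk gx κ Φ t p D) (fT mk fx κ Φ t p D) + 1 ≤ ((nL κ Φ t p D (gT mk gx κ Φ t p D) (fT mk fx κ Φ t p D) * ℓL κ Φ t p D (gT mk gx κ Φ t p D) (fT mk fx κ Φ t p D) / shearUnit (nL κ Φ t p D (gT mk gx κ Φ t p D) (fT mk fx κ Φ t p D)) (hL κ Φ t p D (gT mk gx κ Φ t p D) (fT mk fx κ Φ t p D)) + 1 : ℕ) : ℤ) * (shearUnit (nL κ Φ t p D (gT mk gx κ Φ t p D) (fT mk fx κ Φ t p D)) (hL κ Φ t p D (gT mk gx κ Φ t p D) (fT mk fx κ Φ t p D)) : ℤ) := by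
    have hWlo' := Nat.lt_div_mul_add (a := nL κ Φ t p D (gT mk gx κ Φ t p D) (fT mk fx κ Φ t p D) * ℓL κ Φ t p D (gT mk gx κ Φ t p D) (fT mk fx κ Φ t p D)) hUpos
    have h' : nL κ Φ t p D (gT mk gx κ Φ t p D) (fT mk fx κ Φ t p D) * ℓL κ Φ t p D (gT mk gx κ Φ t p D) (fT mk fx κ Φ t p D) + 1 ≤ (nL κ Φ t p D (gT mk gx κ Φ t p D) (fT mk fx κ Φ t p D) * ℓL κ Φ t p D (gT mk gx κ Φ t p D) (fT mk fx κ Φ t p D) / shearUnit (nL κ Φ t p D (gT mk gx κ Φ t p D) (fT mk fx κ Φ t p D)) (hL κ Φ t p D (gT mk gx κ Φ t p D) (fT mk fx κ Φ t p D)) + 1) * shearUnit (nL κ Φ t p D (gT mk gx κ Φ t p D) (fT mk fx κ Φ t p D)) (hL κ Φ t p D (gT mk gx κ Φ t p D) (fT mk fx κ Φ t p D)) := by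
      rw [Nat.add_mul, one_mul]; omega
    exact_mod_cast h'
  have hab := abs_nonneg (σ * ((nL κ Φ t p D (gT mk gx κ Φ t p D) (fT mk fx κ Φ t p D) : ℤ) * a - hL κ Φ t p D (gT mk gx κ Φ t p D) (fT mk fx κ Φ t p D) * (σ * b)))
  linarith [key, h2a, h2b, hU, hfl', hWlo, abs_nonneg a]

end AtT

end KS

end NegB

end PlanarSkeletonFrm

end Summit.CriticalPhenomena.PercolationContinuityZ3.Theorems.Transplant

end
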